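import Literature.MathematicalPhysics.KineticTheory.TaggedSphereMainTermComparison
import Mathlib.MeasureTheory.Measure.Count
import HarnessLib

/-!
# The null-set input (R) of the BGSR programme, corrected: Duhamel terms of the hard-sphere
# hierarchy respect null sets on DOMAIN-SUPPORTED families
(Bodineau–Gallagher–Saint-Raymond, Invent. Math. 203 (2016) = arXiv:1305.3397v2, §3.1 Remark 3.1,
p. 9, and §5.1 p. 15; Spohn 2006 Thm 11 "independently of the chosen versions"; trunk T-KINETIC,
topic MathematicalPhysics/KineticTheory; a repair layer of the bottom-up plan towards the named fact
`bgsr_linearBoltzmannApprox` (`TaggedSphereDiffusion`) recorded in `TaggedSphereLinearBoltzmannRate`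
/ `TaggedSphereLinearBoltzmannInputs`.)

`TaggedSphereLinearBoltzmannInputs` proves `bgsr_linearBoltzmannApprox` from three inputs (S), (R),
(Reg) on the hard-sphere dynamics. The input (R) was stated there (and in `HardSphereHierarchyModel`,
`bgsrMarginal_ae_abs_sub_blockComp_le`) as `(hsHierarchyModel hε hε' (N+1)).RespectsAE (fun _ => volume)`:
Lebesgue-a.e. equal nice families have Lebesgue-a.e. equal Duhamel terms. **In that form (R) is
false.** The regularised Alexander flows are the identity off the good set, in particular off the
hard-sphere domain `D_ε^k` and on every contact configuration whose adjoined sphere overlaps a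
third one; there the order-one Duhamel term `Q_{s,s+1}(h) G (Z_s) = h · C^{out}_{s,s+1} G_{s+1} (Z_s)`
reads `G_{s+1}` on the (Lebesgue-null) contact set itself, where two a.e.-equal nice families may
differ arbitrarily: e.g. `G₁ = 0` and `G₂^{(s+1)}(W) = e^{-H(W)} 1[(x_{s+1} - x_i)·e₁ > 0, |x_{s+1} - x_i| = ε]`
give `Q_{s,s+1}(h) G₂ (Z_s) = -h c ∑_i ∫_{ω·e₁>0} ω·v_i dσ ≠ 0` on the positive-measure set
`{Z_s ∉ D_ε^s}` (`s ≥ 2`), and likewise on `{Z_s ∈ D_ε^s : |x_i - x_j| < 2ε}` through the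
overlapping adjunctions. (The same objection applies to the Liouville measures `vol|_{D_ε^k}`.)
What IS true (BGSR Remark 3.1, Simonella 2014: non-singularity of the parametrisation of the
pseudo-trajectories) and what every consumer in the tree actually uses, is (R) **restricted to
families vanishing off the hard-sphere domains** — the marginals `bgsrMarginalFamily`, their Duhamel
series, `bgsrInitialMarginals` and their energy truncations all vanish off `D_ε^k`, and for such
data the overlapping adjunctions contribute nothing (`duhamelTerm_hsHierarchyModel_eq_zero_of_not_mem`).

This file re-threads the BBGKY side of the assembly through the corrected input, WITHOUT touching
the abstract machinery (`HierarchyDuhamelSeries` is generic in the family of measures `μ`):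

* §1 `Kinetic.hsDomMeasure ε k := volume + count|_{(D_ε^k)ᶜ}` — Lebesgue measure augmented by the
  counting measure off the hard-sphere domain; `ae_hsDomMeasure_iff`: a property holds
  `hsDomMeasure`-a.e. iff it holds Lebesgue-a.e. AND at every configuration off the domain. Two
  domain-supported functions agree `hsDomMeasure`-a.e. iff they agree Lebesgue-a.e.
  (`eventuallyEq_hsDomMeasure_of_eq_zero`).
* §2 `respectsAE_hsDomMeasure_of_domain` — **the corrected (R) implies
  `RespectsAE (hsDomMeasure ε)`** (split a nice family into its parts on and off the domains,
  `duhamelTerm_add`; the parts off the domains of two `hsDomMeasure`-a.e. equal families coincide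
  exactly; the Duhamel terms of the parts on the domains agree Lebesgue-a.e. by the corrected (R)
  and vanish off the domain); `respectsAE_hsDomMeasure_of_volume` — so does the old (false) form,
  so that the old reductions remain corollaries.
* §3 `bgsrMarginal_ae_abs_sub_blockComp_le_dom`, `bgsrMarginal_ae_abs_sub_truncSepMain_le_dom` —
  the reductions of `HardSphereHierarchyModel` (BGSR Prop. 4.3, Props. 5.4–5.5, BBGKY side) under
  (S) and `RespectsAE (hsDomMeasure ε)`;
* §4 `bgsrInitialMarginals_eq_zero_of_not_mem`,
  `ae_abs_sepBlockComp_marginals_sub_initialMarginals_le_dom` — the data exchange of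
  `TaggedSphereMainTermComparison` under `RespectsAE (hsDomMeasure ε)`;
* §5 `ae_abs_bgsrMarginalFamily_sub_bgsrHierarchyFamily_le_dom` — the assembled comparison at time
  `Kh` (`TaggedSphereMainTermComparison`, STEP 3) under (S), `RespectsAE (hsDomMeasure ε)`, (Reg).

`TaggedSphereLinearBoltzmannInputs` then tunes this into the rate (2.9) and states
`bgsr_linearBoltzmannApprox_of_domainInputs` with the three inputs in their corrected, provable form.
No named fact is introduced; `hsDomMeasure` is the only definition.

## References

* T. Bodineau, I. Gallagher, L. Saint-Raymond, *The Brownian motion as the limit of a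
  deterministic system of hard-spheres*, Invent. Math. 203 (2016) 493–553 = arXiv:1305.3397v2,
  §3.1 Remark 3.1 p. 9; §4.4 Prop. 4.3 p. 13; §5.1 p. 15; §5.3 Props. 5.4–5.5, 5.8, pp. 19–21.
* H. Spohn, *On the integrated form of the BBGKY hierarchy for hard spheres*,
  arXiv:math-ph/0605068, Thm 11, Cor. 12.
* S. Simonella, *Evolution of correlation functions in the hard sphere dynamics*, J. Stat. Phys.
  155 (2014) 1191–1221.
-/

open MeasureTheory Metric Real Set Filter Function
open scoped InnerProductSpace ENNReal Nat
open Literature.Analysis.FluidPDE (Config configEnergy Geometry GCState duhamelTerm duhamelTerm_zero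
  duhamelTerm_succ hardSphereDomain bgsrGoodConfigs)

namespace Literature.MathematicalPhysics.KineticTheory

noncomputable section

open Literature.Analysis.FunctionSpaces.Torus Literature.Analysis.FluidPDE.Torus

section Kinetic

variable {d : Type*} [Fintype d]

/-! ## §1. Lebesgue measure augmented by the counting measure off the hard-sphere domain -/

/-- Lebesgue measure on the `k`-particle phase space over `T^d`, augmented by the counting measure
of the complement of the hard-sphere domain `D_ε^k`: two functions agree almost everywhere for
this measure iff they agree Lebesgue-almost everywhere and at EVERY configuration violating the
exclusion. Feeding this family of measures to `HierarchyModel.RespectsAE` restricts the null-set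
input (R) of the BGSR programme to what is true and used: families supported in the hard-sphere
domains. [folklore] -/
def hsDomMeasure (ε : ℝ) (k : ℕ) : Measure (Config k d (UnitAddTorus d)) :=
  volume + Measure.count.restrict (hardSphereDomain (Literature.Analysis.FluidPDE.Torus.geometry d) k ε)ᶜ

/-- A property holds `hsDomMeasure`-a.e. iff it holds Lebesgue-a.e. and everywhere off the
hard-sphere domain. [folklore] -/
theorem ae_hsDomMeasure_iff {ε : ℝ} {k : ℕ} {p : Config k d (UnitAddTorus d) → Prop} :
    (∀ᵐ Z ∂hsDomMeasure (d := d) ε k, p Z) ↔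
      (∀ᵐ Z, p Z) ∧ ∀ Z ∉ hardSphereDomain (Literature.Analysis.FluidPDE.Torus.geometry d) k ε, p Z := by
  unfold hsDomMeasure
  rw [ae_add_measure_iff, ae_restrict_iff' (measurableSet_hardSphereDomain_torus k ε).compl,
    Measure.ae_count_iff]
  rfl

/-- `hsDomMeasure`-a.e. statements are Lebesgue-a.e. statements. [folklore] -/
theorem ae_of_ae_hsDomMeasure {ε : ℝ} {k : ℕ} {p : Config k d (UnitAddTorus d) → Prop}
    (h : ∀ᵐ Z ∂hsDomMeasure (d := d) ε k, p Z) : ∀ᵐ Z, p Z :=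
  (ae_hsDomMeasure_iff.1 h).1

/-- `hsDomMeasure`-a.e. statements hold everywhere off the hard-sphere domain. [folklore] -/
theorem forall_of_ae_hsDomMeasure {ε : ℝ} {k : ℕ} {p : Config k d (UnitAddTorus d) → Prop}
    (h : ∀ᵐ Z ∂hsDomMeasure (d := d) ε k, p Z) :
    ∀ Z ∉ hardSphereDomain (Literature.Analysis.FluidPDE.Torus.geometry d) k ε, p Z :=
  (ae_hsDomMeasure_iff.1 h).2

/-- Two functions vanishing off the hard-sphere domain and agreeing Lebesgue-a.e. agree
`hsDomMeasure`-a.e. [folklore] -/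
theorem eventuallyEq_hsDomMeasure_of_eq_zero {ε : ℝ} {k : ℕ} {f g : Config k d (UnitAddTorus d) → ℝ}
    (h : f =ᵐ[volume] g)
    (hf : ∀ Z ∉ hardSphereDomain (Literature.Analysis.FluidPDE.Torus.geometry d) k ε, f Z = 0)
    (hg : ∀ Z ∉ hardSphereDomain (Literature.Analysis.FluidPDE.Torus.geometry d) k ε, g Z = 0) :
    f =ᵐ[hsDomMeasure (d := d) ε k] g :=
  ae_hsDomMeasure_iff.2 ⟨h, fun Z hZ => by rw [hf Z hZ, hg Z hZ]⟩

/-! ## §2. The corrected null-set input implies `RespectsAE (hsDomMeasure ε)` -/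

section Respects

variable {X : Type*} [MeasurableSpace X]

/-- The Lanford class is closed under restriction to a measurable set. [folklore] -/
theorem IsNice.indicator {k : ℕ} {g : Config k d X → ℝ} (hg : IsNice g) {s : Set (Config k d X)}
    (hs : MeasurableSet s) : IsNice (s.indicator g) := by
  obtain ⟨K, b, hb, h⟩ := hg.2
  refine ⟨hg.1.indicator hs, K, b, hb, fun Z => ?_⟩
  by_cases hZ : Z ∈ s
  · rw [indicator_of_mem hZ]; exact h Z
  · rw [indicator_of_notMem hZ, abs_zero]; exact (abs_nonneg _).trans (h Z)

end Respects

section RespectsTorus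

variable {ε : ℝ} (hε : 0 < ε) (hε' : ε < 2⁻¹) (Ntot : ℕ)

/-- **Duhamel terms split along the hard-sphere domains**: for a nice family `G` and `h ≥ 0`,
`Q_{s,s+n}(h) G = Q_{s,s+n}(h)[1_D G] + Q_{s,s+n}(h)[1_{Dᶜ} G]` (additivity on nice families,
`duhamelTerm_add`). [folklore] -/
theorem duhamelTerm_hsHierarchyModel_eq_add_indicator {G : GCState d (UnitAddTorus d)}
    (hG : ∀ k, IsNice (G k)) (n s : ℕ) {h : ℝ} (hh : 0 ≤ h) (Z : Config s d (UnitAddTorus d)) :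
    duhamelTerm (hsHierarchyModel (d := d) hε hε' Ntot).transport (hsHierarchyModel hε hε' Ntot).op n s h G Z =
      duhamelTerm (hsHierarchyModel (d := d) hε hε' Ntot).transport (hsHierarchyModel hε hε' Ntot).op n s h
          (fun k => (hardSphereDomain (Literature.Analysis.FluidPDE.Torus.geometry d) k ε).indicator (G k)) Z +
        duhamelTerm (hsHierarchyModel (d := d) hε hε' Ntot).transport (hsHierarchyModel hε hε' Ntot).op n s h
          (fun k => (hardSphereDomain (Literature.Analysis.FluidPDE.Torus.geometry d) k ε)ᶜ.indicator (G k)) Z := by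
  have hP : ∀ k, IsNice ((fun k => (hardSphereDomain (Literature.Analysis.FluidPDE.Torus.geometry d) k ε).indicator
      (G k)) k) := fun k => (hG k).indicator (measurableSet_hardSphereDomain_torus k ε)
  have hQ : ∀ k, IsNice ((fun k => (hardSphereDomain (Literature.Analysis.FluidPDE.Torus.geometry d) k ε)ᶜ.indicator
      (G k)) k) := fun k => (hG k).indicator (measurableSet_hardSphereDomain_torus k ε).compl
  have hsum : G = (fun k => (hardSphereDomain (Literature.Analysis.FluidPDE.Torus.geometry d) k ε).indicator (G k)) +
      fun k => (hardSphereDomain (Literature.Analysis.FluidPDE.Torus.geometry d) k ε)ᶜ.indicator (G k) := by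
    funext k Z'
    simp only [Pi.add_apply]
    exact (congrFun (Set.indicator_self_add_compl _ (G k)) Z').symm
  conv_lhs => rw [hsum]
  exact duhamelTerm_add (hsHierarchyModel (d := d) hε hε' Ntot) hP hQ n s h ⟨hh, le_rfl⟩ Z

/-- **Off the hard-sphere domain a Duhamel term only reads its data off the hard-sphere domains**:
if two nice families agree at every configuration violating the exclusion (all levels), their
Duhamel terms agree at every configuration violating the exclusion (the parts on the domains
contribute nothing there, `duhamelTerm_hsHierarchyModel_eq_zero_of_not_mem`; the parts off the
domains coincide). [folklore] -/
theorem duhamelTerm_hsHierarchyModel_congr_of_not_mem {G₁ G₂ : GCState d (UnitAddTorus d)}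
    (h₁ : ∀ k, IsNice (G₁ k)) (h₂ : ∀ k, IsNice (G₂ k))
    (hoff : ∀ k, ∀ Z ∉ hardSphereDomain (Literature.Analysis.FluidPDE.Torus.geometry d) k ε, G₁ k Z = G₂ k Z)
    (n s : ℕ) {h : ℝ} (hh : 0 ≤ h) {Z : Config s d (UnitAddTorus d)}
    (hZ : Z ∉ hardSphereDomain (Literature.Analysis.FluidPDE.Torus.geometry d) s ε) :
    duhamelTerm (hsHierarchyModel (d := d) hε hε' Ntot).transport (hsHierarchyModel hε hε' Ntot).op n s h G₁ Z =
      duhamelTerm (hsHierarchyModel (d := d) hε hε' Ntot).transport (hsHierarchyModel hε hε' Ntot).op n s h G₂ Z := by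
  have hQ : (fun k => (hardSphereDomain (Literature.Analysis.FluidPDE.Torus.geometry d) k ε)ᶜ.indicator (G₁ k)) =
      fun k => (hardSphereDomain (Literature.Analysis.FluidPDE.Torus.geometry d) k ε)ᶜ.indicator (G₂ k) := by
    funext k Z'
    by_cases hZ' : Z' ∈ hardSphereDomain (Literature.Analysis.FluidPDE.Torus.geometry d) k ε
    · rw [indicator_of_notMem (Set.notMem_compl_iff.2 hZ'), indicator_of_notMem (Set.notMem_compl_iff.2 hZ')]
    · rw [indicator_of_mem hZ', indicator_of_mem hZ', hoff k Z' hZ']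
  have hvan : ∀ (G : GCState d (UnitAddTorus d)) (k : ℕ),
      ∀ Z' ∉ hardSphereDomain (Literature.Analysis.FluidPDE.Torus.geometry d) k ε,
        (fun k => (hardSphereDomain (Literature.Analysis.FluidPDE.Torus.geometry d) k ε).indicator (G k)) k Z' = 0 :=
    fun G k Z' hZ' => indicator_of_notMem hZ' _
  rw [duhamelTerm_hsHierarchyModel_eq_add_indicator hε hε' Ntot h₁ n s hh Z,
    duhamelTerm_hsHierarchyModel_eq_add_indicator hε hε' Ntot h₂ n s hh Z,
    duhamelTerm_hsHierarchyModel_eq_zero_of_not_mem hε hε' Ntot (hvan G₁) n s h Z hZ,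
    duhamelTerm_hsHierarchyModel_eq_zero_of_not_mem hε hε' Ntot (hvan G₂) n s h Z hZ, hQ]

/-- **The corrected null-set input implies `RespectsAE (hsDomMeasure ε)`.** Suppose the Duhamel
terms of the `Ntot`-sphere model respect Lebesgue-null sets on nice families SUPPORTED IN THE
HARD-SPHERE DOMAINS (the true content of BGSR Remark 3.1 / Spohn's "independently of the chosen
versions": non-singularity of the parametrisation of pseudo-trajectories). Then they respect
`hsDomMeasure`-null sets on all nice families: split each family along the domains
(`duhamelTerm_hsHierarchyModel_eq_add_indicator`); the parts off the domains of two
`hsDomMeasure`-a.e. equal families are equal; the parts on the domains have Lebesgue-a.e. equal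
Duhamel terms by hypothesis, vanishing off the domain. [cite: BodineauGallagherSaintRaymondInvent2016, §3.1 Remark 3.1, p. 9] -/
theorem respectsAE_hsDomMeasure_of_domain
    (hR : ∀ (n s : ℕ) {h : ℝ}, 0 ≤ h → ∀ {G₁ G₂ : GCState d (UnitAddTorus d)},
      (∀ k, IsNice (G₁ k)) → (∀ k, IsNice (G₂ k)) →
      (∀ k, ∀ Z ∉ hardSphereDomain (Literature.Analysis.FluidPDE.Torus.geometry d) k ε, G₁ k Z = 0) →
      (∀ k, ∀ Z ∉ hardSphereDomain (Literature.Analysis.FluidPDE.Torus.geometry d) k ε, G₂ k Z = 0) →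
      (∀ k, G₁ k =ᵐ[volume] G₂ k) →
      duhamelTerm (hsHierarchyModel (d := d) hε hε' Ntot).transport (hsHierarchyModel hε hε' Ntot).op n s h G₁
        =ᵐ[volume]
      duhamelTerm (hsHierarchyModel (d := d) hε hε' Ntot).transport (hsHierarchyModel hε hε' Ntot).op n s h G₂) :
    (hsHierarchyModel (d := d) hε hε' Ntot).RespectsAE (hsDomMeasure ε) := by
  intro n s h hh G₁ G₂ h₁ h₂ hae
  have hvol : ∀ k, G₁ k =ᵐ[volume] G₂ k := fun k => ae_of_ae_hsDomMeasure (hae k)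
  have hoff : ∀ k, ∀ Z ∉ hardSphereDomain (Literature.Analysis.FluidPDE.Torus.geometry d) k ε, G₁ k Z = G₂ k Z :=
    fun k => forall_of_ae_hsDomMeasure (hae k)
  set P₁ : GCState d (UnitAddTorus d) := fun k =>
    (hardSphereDomain (Literature.Analysis.FluidPDE.Torus.geometry d) k ε).indicator (G₁ k) with hP₁
  set P₂ : GCState d (UnitAddTorus d) := fun k =>
    (hardSphereDomain (Literature.Analysis.FluidPDE.Torus.geometry d) k ε).indicator (G₂ k) with hP₂
  have hnP₁ : ∀ k, IsNice (P₁ k) := fun k => (h₁ k).indicator (measurableSet_hardSphereDomain_torus k ε)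
  have hnP₂ : ∀ k, IsNice (P₂ k) := fun k => (h₂ k).indicator (measurableSet_hardSphereDomain_torus k ε)
  have hvP₁ : ∀ k, ∀ Z ∉ hardSphereDomain (Literature.Analysis.FluidPDE.Torus.geometry d) k ε, P₁ k Z = 0 :=
    fun k Z hZ => indicator_of_notMem hZ _
  have hvP₂ : ∀ k, ∀ Z ∉ hardSphereDomain (Literature.Analysis.FluidPDE.Torus.geometry d) k ε, P₂ k Z = 0 :=
    fun k Z hZ => indicator_of_notMem hZ _
  have haeP : ∀ k, P₁ k =ᵐ[volume] P₂ k := fun k => by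
    filter_upwards [hvol k] with Z hZ
    show (hardSphereDomain (Literature.Analysis.FluidPDE.Torus.geometry d) k ε).indicator (G₁ k) Z =
      (hardSphereDomain (Literature.Analysis.FluidPDE.Torus.geometry d) k ε).indicator (G₂ k) Z
    by_cases hZD : Z ∈ hardSphereDomain (Literature.Analysis.FluidPDE.Torus.geometry d) k ε
    · rw [indicator_of_mem hZD, indicator_of_mem hZD, hZ]
    · rw [indicator_of_notMem hZD, indicator_of_notMem hZD]
  have hQ : (fun k => (hardSphereDomain (Literature.Analysis.FluidPDE.Torus.geometry d) k ε)ᶜ.indicator (G₁ k)) =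
      fun k => (hardSphereDomain (Literature.Analysis.FluidPDE.Torus.geometry d) k ε)ᶜ.indicator (G₂ k) := by
    funext k Z'
    by_cases hZ' : Z' ∈ hardSphereDomain (Literature.Analysis.FluidPDE.Torus.geometry d) k ε
    · rw [indicator_of_notMem (Set.notMem_compl_iff.2 hZ'), indicator_of_notMem (Set.notMem_compl_iff.2 hZ')]
    · rw [indicator_of_mem hZ', indicator_of_mem hZ', hoff k Z' hZ']
  have hmain := hR n s hh hnP₁ hnP₂ hvP₁ hvP₂ haeP
  refine ae_hsDomMeasure_iff.2 ⟨?_, fun Z hZ => ?_⟩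
  · filter_upwards [hmain] with Z hZ
    rw [duhamelTerm_hsHierarchyModel_eq_add_indicator hε hε' Ntot h₁ n s hh Z,
      duhamelTerm_hsHierarchyModel_eq_add_indicator hε hε' Ntot h₂ n s hh Z, hQ]
    exact congrArg (· + _) hZ
  · exact duhamelTerm_hsHierarchyModel_congr_of_not_mem hε hε' Ntot h₁ h₂ hoff n s hh hZ

/-- The old form of (R) (`RespectsAE (fun _ => volume)`, all nice families) also implies
`RespectsAE (hsDomMeasure ε)` — so that the reductions stated with the old form are corollaries of
those stated with `hsDomMeasure`. (That old form does not hold for the hard-sphere model; see the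
module docstring.) [folklore] -/
theorem respectsAE_hsDomMeasure_of_volume
    (hR : (hsHierarchyModel (d := d) hε hε' Ntot).RespectsAE (fun _ => volume)) :
    (hsHierarchyModel (d := d) hε hε' Ntot).RespectsAE (hsDomMeasure ε) := by
  intro n s h hh G₁ G₂ h₁ h₂ hae
  have hvol : ∀ k, G₁ k =ᵐ[volume] G₂ k := fun k => ae_of_ae_hsDomMeasure (hae k)
  have hoff : ∀ k, ∀ Z ∉ hardSphereDomain (Literature.Analysis.FluidPDE.Torus.geometry d) k ε, G₁ k Z = G₂ k Z :=
    fun k => forall_of_ae_hsDomMeasure (hae k)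
  exact ae_hsDomMeasure_iff.2 ⟨hR n s hh h₁ h₂ hvol, fun Z hZ =>
    duhamelTerm_hsHierarchyModel_congr_of_not_mem hε hε' Ntot h₁ h₂ hoff n s hh hZ⟩

end RespectsTorus

/-! ## §3. The reductions of `HardSphereHierarchyModel` under `RespectsAE (hsDomMeasure ε)` -/

section Marginals

variable {ε : ℝ} (hε : 0 < ε) (hε' : ε < 2⁻¹) (N : ℕ) (β : ℝ) (ρ₀ : UnitAddTorus d → ℝ)

/-- The iterated Duhamel formula up to Lebesgue-null sets (input (S)) is the same identity up to
`hsDomMeasure`-null sets: both sides vanish off the hard-sphere domain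
(`seriesFamily_hsHierarchyModel_eq_zero_of_not_mem`, `bgsrMarginalFamily_eq_zero_of_not_mem`).
[folklore] -/
theorem seriesFamily_ae_eq_bgsrMarginalFamily_dom_of_ae {s : ℕ} {t : ℝ}
    (hS : (hsHierarchyModel (d := d) hε hε' (N + 1)).seriesFamily (N + 1)
        (fun k => bgsrMarginalFamily hε hε' N β ρ₀ k 0) s t =ᵐ[volume]
      bgsrMarginalFamily hε hε' N β ρ₀ s t) :
    (hsHierarchyModel (d := d) hε hε' (N + 1)).seriesFamily (N + 1)
        (fun k => bgsrMarginalFamily hε hε' N β ρ₀ k 0) s t =ᵐ[hsDomMeasure (d := d) ε s]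
      bgsrMarginalFamily hε hε' N β ρ₀ s t :=
  eventuallyEq_hsDomMeasure_of_eq_zero hS
    (fun _ hZ => seriesFamily_hsHierarchyModel_eq_zero_of_not_mem hε hε' (N + 1)
      (fun k _ hZ' => bgsrMarginalFamily_eq_zero_of_not_mem hε hε' N β ρ₀ k 0 hZ') (N + 1) s t hZ)
    (fun _ hZ => bgsrMarginalFamily_eq_zero_of_not_mem hε hε' N β ρ₀ s t hZ)

/-- **The BBGKY side of BGSR Theorem 2.2 reduced to (S) and the corrected (R)** (Proposition 4.3
for the tagged distribution, almost everywhere): `bgsrMarginal_ae_abs_sub_blockComp_le` of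
`HardSphereHierarchyModel` with the null-set input stated for the measures `hsDomMeasure ε`
(equivalently: for domain-supported families, `respectsAE_hsDomMeasure_of_domain`). Same proof:
`HierarchyModel.seriesFamily_ae_abs_sub_blockComp_le` is generic in the family of measures, and
`volume ≤ hsDomMeasure`. Printed: `‖R_N^K‖_∞ ≤ C γ^A ‖ρ⁰‖_∞` (Prop. 4.3, (4.14)).
[cite: BodineauGallagherSaintRaymondInvent2016, §4.4 Prop. 4.3 (4.14), p. 13] -/
theorem bgsrMarginal_ae_abs_sub_blockComp_le_dom (hβ : 0 < β) (hρ₀m : Measurable ρ₀) {R : ℝ}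
    (hρ₀0 : ∀ x, 0 ≤ ρ₀ x) (hR : ∀ x, ρ₀ x ≤ R) (hN : (N : ℝ) * (2 * ε) ^ Fintype.card d ≤ 2⁻¹)
    {T : ℝ}
    (hS : ∀ s ≤ N + 1, ∀ t ∈ Icc 0 T,
      (hsHierarchyModel (d := d) hε hε' (N + 1)).seriesFamily (N + 1)
          (fun k => bgsrMarginalFamily hε hε' N β ρ₀ k 0) s t =ᵐ[hsDomMeasure (d := d) ε s]
        bgsrMarginalFamily hε hε' N β ρ₀ s t)
    (hRob : (hsHierarchyModel (d := d) hε hε' (N + 1)).RespectsAE (hsDomMeasure ε))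
    {A : ℕ} (hA : 2 ≤ A) {γ : ℝ} (hγ0 : 0 ≤ γ) (hγ : γ ≤ 1 / 2) {h : ℝ} (hh0 : 0 ≤ h)
    (hsmall : max 1 (2 * maxwellianConst d β) * (hsHierarchyModel (d := d) hε hε' (N + 1)).pruneConst β * h ≤
      γ / exp 2)
    (K : ℕ) (hKT : K * h ≤ T) :
    ∀ᵐ Z : Config 1 d (UnitAddTorus d), |bgsrMarginalFamily hε hε' N β ρ₀ 1 (K * h) Z -
        (hsHierarchyModel (d := d) hε hε' (N + 1)).blockComp (pruneSeq A) h K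
          (fun a => bgsrMarginalFamily hε hε' N β ρ₀ a 0) 1 Z| ≤
      4 * γ ^ A * R * max 1 (2 * maxwellianConst d β) := by
  set M := hsHierarchyModel (d := d) hε hε' (N + 1) with hMdef
  set P := bgsrMarginalFamily (d := d) hε hε' N β ρ₀ with hPdef
  set C₀ := max 1 (2 * maxwellianConst d β) with hC₀
  have hR0 : 0 ≤ R := (hρ₀0 0).trans (hR 0)
  have hC₀1 : 1 ≤ C₀ := le_max_left _ _
  have hf₀ : ∀ k, IsNice (P k 0) := fun k =>
    ⟨measurable_bgsrMarginalFamily hε hε' N β ρ₀ hρ₀m k 0, R * C₀ ^ k, β, hβ,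
      abs_bgsrMarginalFamily_le hε hε' N β ρ₀ hβ hρ₀0 hR hN k 0⟩
  have hvan : ∀ k, N + 1 < k → P k 0 = 0 := fun k hk => bgsrMarginalFamily_eq_zero_of_lt hε hε' N β ρ₀ hk 0
  have hti : ∀ i < K, K * h - (i + 1) * h ∈ Icc 0 T := by
    intro i hi
    have : (i + 1 : ℝ) ≤ K := by exact_mod_cast hi
    refine ⟨by nlinarith, ?_⟩
    nlinarith [mul_nonneg (by positivity : (0 : ℝ) ≤ i + 1) hh0]
  have hS' : ∀ i < K, ∀ k, M.seriesFamily (N + 1) (fun k => P k 0) k (K * h - (i + 1) * h) =ᵐ[hsDomMeasure (d := d) ε k]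
      P k (K * h - (i + 1) * h) := by
    intro i hi k
    rcases le_or_gt k (N + 1) with hk | hk
    · exact hS k hk _ (hti i hi)
    · refine Eventually.of_forall fun Z => ?_
      rw [HierarchyModel.seriesFamily_eq_zero_of_lt hvan hk, hPdef,
        bgsrMarginalFamily_eq_zero_of_lt hε hε' N β ρ₀ hk]
      rfl
  have hmain := HierarchyModel.seriesFamily_ae_abs_sub_blockComp_le (M := M) (μ := hsDomMeasure (d := d) ε)
    (hsHierarchyModel_flow_add hε hε' (N + 1)) hf₀ hvan hRob
    (fun k τ _ => measurable_bgsrMarginalFamily hε hε' N β ρ₀ hρ₀m k τ) hR0 hC₀1 hβ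
    (fun k τ _ Z => abs_bgsrMarginalFamily_le hε hε' N β ρ₀ hβ hρ₀0 hR hN k τ Z)
    hA hγ0 hγ hh0 hsmall K hKT hS'
  have hK1 : M.seriesFamily (N + 1) (fun k => P k 0) 1 (K * h) =ᵐ[hsDomMeasure (d := d) ε 1] P 1 (K * h) :=
    hS 1 (by omega) _ ⟨by positivity, hKT⟩
  have h0 : (fun a => M.seriesFamily (N + 1) (fun k => P k 0) a 0) = fun a => P a 0 :=
    funext fun a => seriesFamily_hsHierarchyModel_zero hε hε' (N + 1) (N + 1) _ a
  filter_upwards [ae_of_ae_hsDomMeasure hmain, ae_of_ae_hsDomMeasure hK1] with Z hZ hZ1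
  rw [h0, hZ1] at hZ
  exact hZ

/-- **Props. 4.3, 5.4 and 5.5 for the BBGKY hierarchy of the tagged hard-sphere system,
assembled, under (S) and the corrected (R)** (`bgsrMarginal_ae_abs_sub_truncSepMain_le` of
`HardSphereHierarchyModel` with the null-set input for `hsDomMeasure ε`): the tagged distribution
`f_N^{(1)}(Kh)` differs a.e. from the truncated, separated main term by the pruning remainder plus
the energy-truncation and time-separation errors.
[cite: BodineauGallagherSaintRaymondInvent2016, §4.4 Prop. 4.3 and §5.3 Props. 5.4–5.5, pp. 13, 19–20] -/
theorem bgsrMarginal_ae_abs_sub_truncSepMain_le_dom (hβ : 0 < β) (hρ₀m : Measurable ρ₀) {R : ℝ}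
    (hρ₀0 : ∀ x, 0 ≤ ρ₀ x) (hR : ∀ x, ρ₀ x ≤ R) (hN : (N : ℝ) * (2 * ε) ^ Fintype.card d ≤ 2⁻¹)
    {T : ℝ}
    (hS : ∀ s ≤ N + 1, ∀ t ∈ Icc 0 T,
      (hsHierarchyModel (d := d) hε hε' (N + 1)).seriesFamily (N + 1)
          (fun k => bgsrMarginalFamily hε hε' N β ρ₀ k 0) s t =ᵐ[hsDomMeasure (d := d) ε s]
        bgsrMarginalFamily hε hε' N β ρ₀ s t)
    (hRob : (hsHierarchyModel (d := d) hε hε' (N + 1)).RespectsAE (hsDomMeasure ε))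
    {A : ℕ} (hA : 2 ≤ A) {γ : ℝ} (hγ0 : 0 ≤ γ) (hγ : γ ≤ 1 / 2) {h : ℝ} (hh0 : 0 ≤ h)
    (hsmall : max 1 (2 * maxwellianConst d β) * (hsHierarchyModel (d := d) hε hε' (N + 1)).pruneConst β * h ≤
      γ / exp 2)
    (K : ℕ) (hKT : K * h ≤ T) (E : ℝ) {δ : ℝ} (hδ : 0 ≤ δ) :
    ∀ᵐ Z : Config 1 d (UnitAddTorus d), |bgsrMarginalFamily hε hε' N β ρ₀ 1 (K * h) Z -
        (hsHierarchyModel (d := d) hε hε' (N + 1)).sepBlockComp δ (pruneSeq A) h K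
          (energyTruncate E fun a => bgsrMarginalFamily hε hε' N β ρ₀ a 0) 1 Z| ≤
      4 * γ ^ A * R * max 1 (2 * maxwellianConst d β) +
        R * exp (-(β * E ^ 2 / 4)) * max 1 (2 * maxwellianConst d β) *
          exp (6 * (max 1 (2 * maxwellianConst d β) *
            (hsHierarchyModel (d := d) hε hε' (N + 1)).pruneConst (β / 2) * h) * (A : ℝ) ^ K) +
        12 * R * max 1 (2 * maxwellianConst d β) *
          (max 1 (2 * maxwellianConst d β) * (hsHierarchyModel (d := d) hε hε' (N + 1)).pruneConst β * δ) *
          (A : ℝ) ^ (2 * K) *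
          exp (12 * (max 1 (2 * maxwellianConst d β) *
            (hsHierarchyModel (d := d) hε hε' (N + 1)).pruneConst β * h) * (A : ℝ) ^ K) := by
  set M := hsHierarchyModel (d := d) hε hε' (N + 1) with hMdef
  set G0 : GCState d (UnitAddTorus d) := fun a => bgsrMarginalFamily (d := d) hε hε' N β ρ₀ a 0 with hG0
  have hR0 : 0 ≤ R := (hρ₀0 0).trans (hR 0)
  have hC' : 1 ≤ max 1 (2 * maxwellianConst d β) := le_max_left _ _
  have hnice : ∀ k, IsNice (G0 k) := fun k =>
    ⟨measurable_bgsrMarginalFamily hε hε' N β ρ₀ hρ₀m k 0, R * (max 1 (2 * maxwellianConst d β)) ^ k, β, hβ,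
      abs_bgsrMarginalFamily_le hε hε' N β ρ₀ hβ hρ₀0 hR hN k 0⟩
  have hlev : IsLevelBdd G0 (pruneLevel A K) R (max 1 (2 * maxwellianConst d β)) β :=
    isLevelBdd_bgsrMarginalFamily_zero hε hε' N β ρ₀ hβ hρ₀0 hR hN _
  have h1 := bgsrMarginal_ae_abs_sub_blockComp_le_dom hε hε' N β ρ₀ hβ hρ₀m hρ₀0 hR hN hS hRob hA hγ0 hγ
    hh0 hsmall K hKT
  filter_upwards [h1] with Z hZ
  have h2 := M.abs_blockComp_sub_energyTruncate_le hA hR0 hC' hβ hnice K hlev hh0 E Z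
  have hlevE : IsLevelBdd (energyTruncate E G0) (pruneLevel A K) R (max 1 (2 * maxwellianConst d β)) β :=
    fun a ha Z' => (abs_energyTruncate_le E G0 a Z').trans (hlev a ha Z')
  have h3 := M.abs_blockComp_sub_sepBlockComp_le_of_budget hδ hA hR0 hC' hβ
    (fun k => (hnice k).energyTruncate E) K hlevE hh0 Z
  calc _ = |(bgsrMarginalFamily hε hε' N β ρ₀ 1 (K * h) Z - M.blockComp (pruneSeq A) h K G0 1 Z) +
            (M.blockComp (pruneSeq A) h K G0 1 Z - M.blockComp (pruneSeq A) h K (energyTruncate E G0) 1 Z) +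
            (M.blockComp (pruneSeq A) h K (energyTruncate E G0) 1 Z -
              M.sepBlockComp δ (pruneSeq A) h K (energyTruncate E G0) 1 Z)| := by
          congr 1; ring
    _ ≤ _ := (abs_add_three _ _ _)
    _ ≤ _ := add_le_add (add_le_add hZ h2) h3

end Marginals

/-! ## §4. The data exchange under `RespectsAE (hsDomMeasure ε)` -/

section DataExchange

variable {ε : ℝ} {hε : 0 < ε} {hε' : ε < 2⁻¹} {N : ℕ} {β : ℝ} {ρ₀ : UnitAddTorus d → ℝ}

/-- The honest initial marginals vanish off the hard-sphere domains (the datum (2.8) carries the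
indicator of `D_ε^{N+1}`, and an extension of a configuration violating the exclusion violates
it). [folklore] -/
theorem bgsrInitialMarginals_eq_zero_of_not_mem (s : ℕ) {Z : Config s d (UnitAddTorus d)}
    (hZ : Z ∉ hardSphereDomain (Literature.Analysis.FluidPDE.Torus.geometry d) s ε) :
    bgsrInitialMarginals hε hε' N β ρ₀ s Z = 0 := by
  cases s with
  | zero => exact bgsrMarginalFamily_eq_zero_of_not_mem hε hε' N β ρ₀ 0 0 hZ
  | succ s =>
    rw [bgsrInitialMarginals_succ]
    unfold Literature.Analysis.FluidPDE.nthMarginal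
    split_ifs with hs
    · unfold Literature.Analysis.FluidPDE.marginal
      refine integral_eq_zero_of_ae (Eventually.of_forall fun Zm => ?_)
      have hno := Literature.Analysis.FluidPDE.append_not_mem_hardSphereDomain
        (G := Literature.Analysis.FluidPDE.Torus.geometry d) (ε := ε) (Nat.add_sub_of_le hs).symm hZ Zm
      simp only [bgsrInitialDensity, Literature.Analysis.FluidPDE.canonicalDensity, indicator_of_notMem hno,
        mul_zero, zero_mul, Pi.zero_apply]
    · rfl

variable (hε hε' N)

/-- **The BBGKY data may be exchanged for the honest initial marginals, almost everywhere, at the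
price of the separation error — under the corrected (R)**
(`ae_abs_sepBlockComp_marginals_sub_initialMarginals_le` of `TaggedSphereMainTermComparison` with
`RespectsAE (hsDomMeasure ε)`): the two data agree Lebesgue-a.e. (`bgsrInitialMarginals_ae_eq`) and
both vanish off the domains, hence agree `hsDomMeasure`-a.e.; the rest of the proof is unchanged.
[cite: BodineauGallagherSaintRaymondInvent2016, §5.3.2 Prop. 5.5, pp. 19–20] -/
theorem ae_abs_sepBlockComp_marginals_sub_initialMarginals_le_dom (hβ : 0 < β) {R : ℝ}
    (hρ₀c : Continuous ρ₀) (hρ₀0 : ∀ x, 0 ≤ ρ₀ x) (hR : ∀ x, ρ₀ x ≤ R)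
    (hN : (N : ℝ) * (2 * ε) ^ Fintype.card d ≤ 2⁻¹)
    (hRob : (hsHierarchyModel (d := d) hε hε' (N + 1)).RespectsAE (hsDomMeasure ε))
    {A : ℕ} (hA : 2 ≤ A) (K : ℕ) {h δ : ℝ} (hδ : 0 ≤ δ) (hh0 : 0 ≤ h) (E : ℝ) :
    ∀ᵐ Z : Config 1 d (UnitAddTorus d),
      |(hsHierarchyModel (d := d) hε hε' (N + 1)).sepBlockComp δ (pruneSeq A) h K
            (energyTruncate E fun a => bgsrMarginalFamily (d := d) hε hε' N β ρ₀ a 0) 1 Z -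
          (hsHierarchyModel (d := d) hε hε' (N + 1)).sepBlockComp δ (pruneSeq A) h K
            (energyTruncate E (bgsrInitialMarginals hε hε' N β ρ₀)) 1 Z| ≤
        12 * (2 * R) * max 1 (2 * maxwellianConst d β) *
          (max 1 (2 * maxwellianConst d β) * (hsHierarchyModel (d := d) hε hε' (N + 1)).pruneConst β * δ) *
          (A : ℝ) ^ (2 * K) *
          exp (12 * (max 1 (2 * maxwellianConst d β) * (hsHierarchyModel (d := d) hε hε' (N + 1)).pruneConst β * h) *
            (A : ℝ) ^ K) := by
  set M₁ := hsHierarchyModel (d := d) hε hε' (N + 1) with hM₁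
  set C' : ℝ := max 1 (2 * maxwellianConst d β) with hC'
  set F0 : GCState d (UnitAddTorus d) := fun a => bgsrMarginalFamily (d := d) hε hε' N β ρ₀ a 0 with hF0
  set F0' : GCState d (UnitAddTorus d) := bgsrInitialMarginals hε hε' N β ρ₀ with hF0'
  set D : GCState d (UnitAddTorus d) := F0 - F0' with hD
  have hR0 : 0 ≤ R := (hρ₀0 0).trans (hR 0)
  have hC'1 : 1 ≤ C' := le_max_left _ _
  have hρ₀m : Measurable ρ₀ := hρ₀c.measurable
  have hnF : ∀ k, IsNice (F0 k) := fun k =>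
    ⟨measurable_bgsrMarginalFamily hε hε' N β ρ₀ hρ₀m k 0, R * C' ^ k, β, hβ,
      abs_bgsrMarginalFamily_le hε hε' N β ρ₀ hβ hρ₀0 hR hN k 0⟩
  have hnF' : ∀ k, IsNice (F0' k) := fun k => isNice_bgsrInitialMarginals hβ hρ₀m hρ₀0 hR hN k
  have hnD : ∀ k, IsNice (D k) := fun k => (hnF k).sub (hnF' k)
  have hnTF : ∀ k, IsNice (energyTruncate E F0 k) := fun k => (hnF k).energyTruncate E
  have hnTF' : ∀ k, IsNice (energyTruncate E F0' k) := fun k => (hnF' k).energyTruncate E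
  have hnTD : ∀ k, IsNice (energyTruncate E D k) := fun k => (hnD k).energyTruncate E
  have heT : energyTruncate E F0 - energyTruncate E F0' = energyTruncate E D := by
    funext k Z
    simp only [Pi.sub_apply, energyTruncate_apply, hD]
    split_ifs <;> simp
  have hsub : ∀ Z : Config 1 d (UnitAddTorus d),
      M₁.sepBlockComp δ (pruneSeq A) h K (energyTruncate E F0) 1 Z -
        M₁.sepBlockComp δ (pruneSeq A) h K (energyTruncate E F0') 1 Z =
      M₁.sepBlockComp δ (pruneSeq A) h K (energyTruncate E D) 1 Z := by
    intro Z
    have h := HierarchyModel.sepBlockComp_sub (M := M₁) hδ (pruneSeq A) hh0 K hnTF hnTF'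
    rw [heT] at h
    rw [h]; rfl
  -- the truncated difference vanishes `hsDomMeasure`-a.e., level by level
  have hDoff : ∀ k, ∀ Z ∉ hardSphereDomain (Literature.Analysis.FluidPDE.Torus.geometry d) k ε,
      energyTruncate E D k Z = 0 := by
    intro k Z hZ
    have hDZ : D k Z = 0 := by
      simp only [hD, Pi.sub_apply, hF0, hF0']
      rw [bgsrMarginalFamily_eq_zero_of_not_mem hε hε' N β ρ₀ k 0 hZ, bgsrInitialMarginals_eq_zero_of_not_mem k hZ,
        sub_self]
    simp only [energyTruncate_apply, hDZ, ite_self]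
  have hae : ∀ k, energyTruncate E D k =ᵐ[hsDomMeasure (d := d) ε k] (0 : GCState d (UnitAddTorus d)) k := by
    intro k
    refine eventuallyEq_hsDomMeasure_of_eq_zero ?_ (hDoff k) (fun _ _ => rfl)
    filter_upwards [bgsrInitialMarginals_ae_eq (hε := hε) (hε' := hε') (N := N) (β := β) (ρ₀ := ρ₀) k] with Z hZ
    have hDZ : D k Z = 0 := by
      simp only [hD, Pi.sub_apply, hF0, hF0']
      rw [hZ, sub_self]
    simp only [energyTruncate_apply, hDZ, Pi.zero_apply, ite_self]
  have hzero : ∀ Z : Config 1 d (UnitAddTorus d), M₁.blockComp (pruneSeq A) h K (0 : GCState d (UnitAddTorus d)) 1 Z = 0 := by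
    intro Z
    have hA1 : 1 ≤ A := by omega
    have hlev : IsLevelBdd (0 : GCState d (UnitAddTorus d)) (pruneLevel A K) 0 1 (1 + K) := by
      intro a _ Z'; simp
    have h := M₁.abs_blockComp_le hA1 one_pos le_rfl (fun _ => (1 : ℝ)) (fun _ => one_pos) hh0 K 0 0 (1 + K)
      le_rfl (by simp) hlev Z
    simpa using h
  have hbc := HierarchyModel.blockComp_congr_ae (M := M₁) hRob (pruneSeq A) hh0 K hnTD
    (fun _ => IsNice.zero) hae 1
  have hlevD : IsLevelBdd (energyTruncate E D) (pruneLevel A K) (2 * R) C' β := by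
    intro a _ Z
    refine (abs_energyTruncate_le E D a Z).trans ?_
    calc |D a Z| = |F0 a Z - F0' a Z| := rfl
      _ ≤ |F0 a Z| + |F0' a Z| := abs_sub _ _
      _ ≤ R * C' ^ a * exp (-β * configEnergy Z) + R * C' ^ a * exp (-β * configEnergy Z) :=
          add_le_add (abs_bgsrMarginalFamily_le hε hε' N β ρ₀ hβ hρ₀0 hR hN a 0 Z)
            (abs_bgsrInitialMarginals_le hβ hρ₀0 hR hN a Z)
      _ = 2 * R * C' ^ a * exp (-β * configEnergy Z) := by ring
  filter_upwards [ae_of_ae_hsDomMeasure hbc] with Z hZ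
  rw [hsub Z]
  have hsep := M₁.abs_blockComp_sub_sepBlockComp_le_of_budget hδ hA (by positivity : 0 ≤ 2 * R) hC'1 hβ hnTD K
    hlevD hh0 Z
  have h0 : M₁.blockComp (pruneSeq A) h K (energyTruncate E D) 1 Z = 0 := by
    rw [hZ]; exact hzero Z
  calc |M₁.sepBlockComp δ (pruneSeq A) h K (energyTruncate E D) 1 Z|
      = |M₁.blockComp (pruneSeq A) h K (energyTruncate E D) 1 Z -
          M₁.sepBlockComp δ (pruneSeq A) h K (energyTruncate E D) 1 Z| := by rw [h0, zero_sub, abs_neg]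
    _ ≤ _ := hsep

end DataExchange

/-! ## §5. The assembled comparison at time `Kh` under (S), the corrected (R), (Reg) -/

section MainTerms

variable [DecidableEq d]
variable {ε : ℝ} (hε : 0 < ε) (hε' : ε < 2⁻¹) (N : ℕ) {β : ℝ} (hβ : 0 < β) {ρ₀ : UnitAddTorus d → ℝ}
  {R : ℝ} (hρ₀c : Continuous ρ₀) (hρ₀0 : ∀ x, 0 ≤ ρ₀ x) (hR : ∀ x, ρ₀ x ≤ R)
  (hN : (N : ℝ) * (2 * ε) ^ Fintype.card d ≤ 2⁻¹) {α : ℝ}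
  (hαN : α = (N + 1 : ℝ) * ε ^ (Fintype.card d - 1))

include hβ hρ₀c hρ₀0 hR hN hαN

/-- **BGSR Props. 4.3, 5.3–5.7 assembled under (S), the corrected (R) and (Reg)**
(`ae_abs_bgsrMarginalFamily_sub_bgsrHierarchyFamily_le` of `TaggedSphereMainTermComparison`, with
the BBGKY-side inputs taken for the measures `hsDomMeasure ε`): for a.e. `Z : Config 1`,
`|f_N^{(1)}(Kh)(Z) - (φ_α(Kh) M_β)(Z)|` is at most the BBGKY-side reduction error
(`bgsrMarginal_ae_abs_sub_truncSepMain_le_dom`), the data-exchange error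
(`ae_abs_sepBlockComp_marginals_sub_initialMarginals_le_dom`), the comparison of the main terms
(`abs_sepBlockComp_hs_sub_boltzmann_le`) and the Boltzmann-side reduction error
(`abs_bgsrHierarchyFamily_sub_truncSepMain_le_torus`). Printed: Prop. 5.8 before tuning, p. 21.
[cite: BodineauGallagherSaintRaymondInvent2016, §5.3.4 Prop. 5.8 proof, p. 21] -/
theorem ae_abs_bgsrMarginalFamily_sub_bgsrHierarchyFamily_le_dom {T : ℝ}
    (hS : ∀ s ≤ N + 1, ∀ t ∈ Icc 0 T,
      (hsHierarchyModel (d := d) hε hε' (N + 1)).seriesFamily (N + 1)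
          (fun k => bgsrMarginalFamily hε hε' N β ρ₀ k 0) s t =ᵐ[hsDomMeasure (d := d) ε s]
        bgsrMarginalFamily hε hε' N β ρ₀ s t)
    (hRob : (hsHierarchyModel (d := d) hε hε' (N + 1)).RespectsAE (hsDomMeasure ε))
    {A : ℕ} (hA : 2 ≤ A) {K : ℕ} (hK : 1 ≤ K) {h δ : ℝ} (hδ : 0 < δ) (hh : δ ≤ h) (hKT : K * h ≤ T)
    {γ : ℝ} (hγ0 : 0 ≤ γ) (hγ : γ ≤ 1 / 2)
    (hsmall : max 1 (2 * maxwellianConst d β) * (hsHierarchyModel (d := d) hε hε' (N + 1)).pruneConst β * h ≤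
      γ / exp 2)
    {E : ℝ} (hE : 0 ≤ E) {ā ε₀ : ℝ} (hāε₀ : 4 * ā ≤ ε₀)
    (hLε : (pruneLevel A K + 1 : ℝ) * ε ≤ ā) (hLN : pruneLevel A K ≤ N + 1) {mBad : ℝ} (hmBad0 : 0 ≤ mBad)
    (hmBad : ∀ k ≤ pruneLevel A K, ∀ (Y : Config k d (UnitAddTorus d)) (m : Fin k) (σ' : ℝ), 0 ≤ σ' →
      Y ∈ bgsrGoodConfigs (Literature.Analysis.FluidPDE.Torus.geometry d) k ε₀ σ' →
      ((sphereMeasure (E := EuclideanSpace ℝ d)).prod (volume : Measure (EuclideanSpace ℝ d)))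
          {q : sphere (0 : EuclideanSpace ℝ d) 1 × EuclideanSpace ℝ d |
            ‖q.2‖ ≤ E ∧ ((q.1 : EuclideanSpace ℝ d), q.2) ∈ bgsrBadSet (K * h) ā ε₀ δ (3 * E) Y m} ≤
        ENNReal.ofReal mBad)
    (hreg : ∀ᵐ z : Config 1 d (UnitAddTorus d), ∀ n, bgsrRegular ε n 1 (K * h) z) :
    ∀ᵐ Z : Config 1 d (UnitAddTorus d),
      |bgsrMarginalFamily (d := d) hε hε' N β ρ₀ 1 (K * h) Z -
          bgsrHierarchyFamily β
            (linearBoltzmannSeries (Literature.Analysis.FluidPDE.Torus.geometry d) β α fun x _ => ρ₀ x) 1 (K * h) Z| ≤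
        (4 * γ ^ A * R * max 1 (2 * maxwellianConst d β) +
          R * exp (-(β * E ^ 2 / 4)) * max 1 (2 * maxwellianConst d β) *
            exp (6 * (max 1 (2 * maxwellianConst d β) *
              (hsHierarchyModel (d := d) hε hε' (N + 1)).pruneConst (β / 2) * h) * (A : ℝ) ^ K) +
          12 * R * max 1 (2 * maxwellianConst d β) *
            (max 1 (2 * maxwellianConst d β) * (hsHierarchyModel (d := d) hε hε' (N + 1)).pruneConst β * δ) *
            (A : ℝ) ^ (2 * K) *
            exp (12 * (max 1 (2 * maxwellianConst d β) *
              (hsHierarchyModel (d := d) hε hε' (N + 1)).pruneConst β * h) * (A : ℝ) ^ K)) +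
        12 * (2 * R) * max 1 (2 * maxwellianConst d β) *
          (max 1 (2 * maxwellianConst d β) * (hsHierarchyModel (d := d) hε hε' (N + 1)).pruneConst β * δ) *
          (A : ℝ) ^ (2 * K) *
          exp (12 * (max 1 (2 * maxwellianConst d β) * (hsHierarchyModel (d := d) hε hε' (N + 1)).pruneConst β * h) *
            (A : ℝ) ^ K) +
        max 1 (4 * maxwellianConst d β) *
          (2 * R * (N + 1) * (2 * ε) ^ Fintype.card d +
            6 * max R 1 * (A : ℝ) ^ K * (pruneLevel A K * ε ^ (Fintype.card d - 1) / α + 4 * E * mBad)) *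
          exp ((6 * (boltzmannModel (Literature.Analysis.FluidPDE.Torus.geometry d) measurable_translate_torus α).pruneConst β +
            12 * α) * max 1 (4 * maxwellianConst d β) * h * (A : ℝ) ^ K) +
        (2 * γ ^ A * max R 1 * max 1 (maxwellianConst d β) +
          max R 1 * exp (-(β * E ^ 2 / 4)) * max 1 (maxwellianConst d β) *
            exp (6 * (max 1 (maxwellianConst d β) *
              (boltzmannModel (Literature.Analysis.FluidPDE.Torus.geometry d) measurable_translate_torus α).pruneConst
                (β / 2) * h) * (A : ℝ) ^ K) +
          12 * max R 1 * max 1 (maxwellianConst d β) *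
            (max 1 (maxwellianConst d β) *
              (boltzmannModel (Literature.Analysis.FluidPDE.Torus.geometry d) measurable_translate_torus α).pruneConst β * δ) *
            (A : ℝ) ^ (2 * K) *
            exp (12 * (max 1 (maxwellianConst d β) *
              (boltzmannModel (Literature.Analysis.FluidPDE.Torus.geometry d) measurable_translate_torus α).pruneConst β * h) *
              (A : ℝ) ^ K)) := by
  set M₁ := hsHierarchyModel (d := d) hε hε' (N + 1) with hM₁
  set M₂ := boltzmannModel (Literature.Analysis.FluidPDE.Torus.geometry d) measurable_translate_torus α with hM₂
  have hρ₀m : Measurable ρ₀ := hρ₀c.measurable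
  have hα0 : 0 ≤ α := by rw [hαN]; have := hε.le; positivity
  have hmc : 0 < maxwellianConst d β := maxwellianConst_pos hβ
  have hopc : M₁.opConst = M₂.opConst := by
    show (((N + 1 : ℕ) : ℝ) * ε ^ (Fintype.card d - 1)) *
        ((∫ u : EuclideanSpace ℝ d, (1 + ‖u‖) * exp (-(1 / 2) * ‖u‖ ^ 2)) *
          (sphereMeasure (E := EuclideanSpace ℝ d)).real univ) =
      |α| * ((∫ u : EuclideanSpace ℝ d, (1 + ‖u‖) * exp (-(1 / 2) * ‖u‖ ^ 2)) *
          (sphereMeasure (E := EuclideanSpace ℝ d)).real univ)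
    rw [hαN, abs_of_nonneg (by have := hε.le; positivity)]
    push_cast; ring
  have hpc : ∀ b', M₂.pruneConst b' = M₁.pruneConst b' := fun b' => by
    simp only [HierarchyModel.pruneConst, hopc]
  have hsmall₂ : max 1 (maxwellianConst d β) * M₂.pruneConst β * h ≤ γ / exp 2 := by
    refine le_trans ?_ hsmall
    rw [hpc]
    have h1 : max 1 (maxwellianConst d β) ≤ max 1 (2 * maxwellianConst d β) := max_le_max le_rfl (by linarith)
    have := M₁.pruneConst_nonneg β
    have hh0 : 0 ≤ h := hδ.le.trans hh
    exact mul_le_mul_of_nonneg_right (mul_le_mul_of_nonneg_right h1 this) hh0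
  have h1 := bgsrMarginal_ae_abs_sub_truncSepMain_le_dom hε hε' N β ρ₀ hβ hρ₀m hρ₀0 hR hN hS hRob hA hγ0 hγ
    (hδ.le.trans hh) hsmall K hKT E hδ.le
  have h2 := ae_abs_sepBlockComp_marginals_sub_initialMarginals_le_dom hε hε' N hβ hρ₀c hρ₀0 hR hN hRob hA K
    hδ.le (hδ.le.trans hh) E
  filter_upwards [h1, h2, hreg] with Z hZ1 hZ2 hZreg
  have h3 := abs_sepBlockComp_hs_sub_boltzmann_le hε hε' N hβ hρ₀c hρ₀0 hR hN hαN hA hK hδ hh hE hāε₀ hLε hLN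
    hmBad0 hmBad hZreg
  have h4 := abs_bgsrHierarchyFamily_sub_truncSepMain_le_torus (d := d) hβ hα0 hρ₀c hρ₀0 hR hA hγ0 hγ
    (hδ.le.trans hh) hsmall₂ E hδ.le K Z
  exact abs_sub_le_of_four hZ1 hZ2 h3 h4

end MainTerms

end Kinetic

end

end Literature.MathematicalPhysics.KineticTheory
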